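import Summits.BirchSwinnertonDyer.BirchSwinnertonDyer.Theorems.GenusKolyvaginAtTwoGenusPrimitiveSupplyAtTwoTwistingPrimeLevelDatum
import HarnessLib

/-!
# Route `GenusKolyvaginAtTwo`, crux #2 `GenusPrimitiveSupplyAtTwo` (stmt-BirchSwinnertonDyer-22136):
# ENTANGLEMENT IS A LEVEL-`4` PHENOMENON — a class of `H¹(ℚ, E[2])` dying on `Γ_{ℚ(E[2^M])}` dies on `Γ_{ℚ(E[4])}`

Width seat `bsd-line-gk2-p4` g10, cell `bsd-f1-sign2`; helper (`--supports stmt-BirchSwinnertonDyer-22136`),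
§43–§44 of the twisting-prime series (after `…TwistingPrimeLevelDatum`). THEOREMS ONLY: no definition, no named
fact, no `sorry`; no item is closed; BSD is not proved by any of this.

WHY. Every depth-`M` statement of the series (g8 `exists_kolyvaginPrime_pow_genusPair_selmer_of_cor34i_of_half`,
g9 `exists_selmer_h1Eval_ne_iff_forall_exists_kolyvaginPrime_evenTwist_selmer_eq_one`, …) carries the
non-entanglement hypothesis «some class does not die on `Γ_{ℚ(E[2^M])}`», discharged so far only at `M = 2`
(g8 `eq_of_forall_torsionFixing_four_h1Eval_eq_zero`: `#Inf H¹(Gal(ℚ(E[4])/ℚ), E[2]) ≤ 2`), the case `M ≥ 3`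
being «remark only (Frattini argument)» in `Lines/genus-supply-depth-class.md` §2(b) and NOT done in g9's census.
This file proves it for EVERY `M`: for the `2`-adic tower of `W` surjective (the habitat binder of crux 22136 / U)
and `M ≥ 2`, a class `x ∈ H¹(ℚ, E[2])` with `[x, h] = 0` for all `h ∈ Γ_{ℚ(E[2^M])}` has `[x, h] = 0` for all
`h ∈ Γ_{ℚ(E[4])}` (`forall_torsionFixing_four_h1Eval_eq_zero_of_forall_torsionFixing_pow`). Hence
`Inf H¹(Gal(ℚ(E[2^M])/ℚ), E[2])` is the level-`4` kernel for all `M ≥ 2` — at most two elements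
(`eq_of_forall_torsionFixing_pow_h1Eval_eq_zero`; Lawson–Wuthrich: `H¹(GL₂(ℤ/2^M), 𝔽₂²) = H¹(GL₂(ℤ/4), 𝔽₂²) = 𝔽₂`)
— and the `W`-side hypothesis of the depth-`M` capstone is automatic on the habitat for every `M`
(`exists_selmer_h1Eval_ne_pow_of_card_eq_four`). The twin-side consequences are in `…TwistingPrimeLevelFourTwin`.

THE ARGUMENT. `φ = [x, ·]` is a `Γ_ℚ`-equivariant homomorphism on `Γ_{ℚ(E[2])}` with values in `E[2]`, killing
`Γ_{ℚ(E[2^M])}`. DESCENT (§43 `forall_torsionFixing_h1Eval_eq_zero_descent`): if `φ` kills `Γ_{ℚ(E[2^{k+2}])}`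
(`k ≥ 2`) it kills `Γ_{ℚ(E[2^{k+1}])}`, since every element there is `s²` times an element of `Γ_{ℚ(E[2^{k+2}])}`
with `s ∈ Γ_{ℚ(E[2^k])}` (`datum_sq_of_two_le` + surjectivity of `ρ_{E,2^{k+1}}`) and `φ(s²) = 2φ(s) = 0`; so `φ`
kills `Γ_{ℚ(E[8])}`. LEVEL `4 → 8` (§43 `forall_torsionFixing_sq_h1Eval_eq_zero_of_cube`): on
`Γ_{ℚ(E[4])}/Γ_{ℚ(E[8])} ≅ M₂(𝔽₂)` (level-`2` data) `φ` is an additive `GL₂(𝔽₂)`-equivariant `F : M₂(𝔽₂) → 𝔽₂²`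
killing every `B + B²` (squares of level-`1` realisations, `datum_sq_one`), hence `F = 0`
(`twoByTwo_equivariant_eq_zero_of_sq`).

References: [LawsonWuthrich2016] §3 (Lemma 6, Thm. 1 at p = 2); [Serre1972] §4; [GrossLMS1991] §9 Prop. 9.1;
[MazurRubin2010] §3.
-/

set_option linter.dupNamespace false -- tree convention: `Summit.BirchSwinnertonDyer.BirchSwinnertonDyer.Theorems` (summit = sub-problem)
set_option autoImplicit false

noncomputable section

open scoped Classical Pointwise

namespace Summit.BirchSwinnertonDyer.BirchSwinnertonDyer.Theorems.GenusKolyTwistingPrime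

open WeierstrassCurve NumberField IsDedekindDomain Field
open Literature.NumberTheory.GaloisRepresentations Literature.NumberTheory.EllipticCurves
open Literature.NumberTheory Matrix

/-! ## §43 The homomorphism `φ = [x, ·]` of a dying class: descent to level `8`, then to level `4` -/

section Descent

variable (W : WeierstrassCurve ℚ)

/-- `[x, s] + [x, s] = 0` (values in `E[2]`). [folklore] -/
theorem h1Eval_two_add_self (x : galH1Torsion W (2 : ℤ)) (s : absoluteGaloisGroup ℚ) :
    h1Eval W (2 : ℤ) x s + h1Eval W (2 : ℤ) x s = 0 :=
  Subtype.ext (by rw [AddSubgroup.coe_add, AddSubgroup.coe_zero]; exact coe_add_self_geomTorsion_two W _)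

/-- **DESCENT STEP (`k ≥ 2`): if `[x, ·]` kills `Γ_{ℚ(E[2^{k+2}])}` it kills `Γ_{ℚ(E[2^{k+1}])}`**, for
`ρ_{E,2^{k+1}}` onto. Every `g' ∈ Γ_{ℚ(E[2^{k+1}])}` is `s²` times an element of `Γ_{ℚ(E[2^{k+2}])}` with
`s ∈ Γ_{ℚ(E[2^k])}` (realise the level-`(k+1)` datum of `g'` at level `k` and square: `datum_sq_of_two_le`),
and `[x, s²] = 2[x, s] = 0`. Group-theoretically: squaring maps `U^{(k)}/U^{(k+1)}` ONTO `U^{(k+1)}/U^{(k+2)}`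
in `U = ker(GL₂(ℤ₂) → GL₂(𝔽₂))` for `k ≥ 2`. [cite: LawsonWuthrich2016, §3] [cite: Serre1972, §4] -/
theorem forall_torsionFixing_h1Eval_eq_zero_descent {k : ℕ} (hk : 2 ≤ k)
    (hsurj : W.HasSurjectiveModNGaloisRep ((2 : ℤ) ^ (k + 1))) (x : galH1Torsion W (2 : ℤ))
    (hx : ∀ h ∈ torsionFixing W ((2 : ℤ) ^ (k + 1 + 1)), h1Eval W (2 : ℤ) x h = 0) :
    ∀ h ∈ torsionFixing W ((2 : ℤ) ^ (k + 1)), h1Eval W (2 : ℤ) x h = 0 := by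
  intro g' hg'
  have hT2 : torsionFixing W ((2 : ℤ) ^ (k + 1 + 1)) ≤ torsionFixing W (2 : ℤ) :=
    KolyvaginLowerBoundAtTwo.torsionFixing_le_of_dvd W (dvd_pow_self 2 (by omega))
  have hTk : torsionFixing W ((2 : ℤ) ^ k) ≤ torsionFixing W (2 : ℤ) :=
    KolyvaginLowerBoundAtTwo.torsionFixing_le_of_dvd W (dvd_pow_self 2 (by omega))
  obtain ⟨A, hA⟩ := exists_datum_of_mem_torsionFixing_zpow W hg'
  obtain ⟨s, hs⟩ := exists_datum_eq_of_hasSurjectiveModNGaloisRep W (by omega : 1 ≤ k) hsurj A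
  have hsT : s ∈ torsionFixing W ((2 : ℤ) ^ k) := mem_torsionFixing_zpow_of_datum W hs
  have hss := datum_sq_of_two_le W hk hs
  have hmem : g' * (s * s)⁻¹ ∈ torsionFixing W ((2 : ℤ) ^ (k + 1 + 1)) :=
    mul_inv_mem_torsionFixing_zpow_succ_of_datum W (by omega : 1 ≤ k + 1) hss hA
  have e : g' = (g' * (s * s)⁻¹) * (s * s) := by group
  rw [e, h1Eval_mul W _ x (hT2 hmem), hx _ hmem, zero_add, h1Eval_mul W _ x (hTk hsT)]
  exact h1Eval_two_add_self W x s

/-- **THE LEVEL-`4 → 8` STEP: if `[x, ·]` kills `Γ_{ℚ(E[8])}` it kills `Γ_{ℚ(E[4])}`**, for `ρ̄_{E,2}`,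
`ρ_{E,4}`, `ρ_{E,8}` onto. On `Γ_{ℚ(E[4])}/Γ_{ℚ(E[8])} ≅ M₂(𝔽₂)` (level-`2` data) `[x, ·]` is an additive
`GL₂(𝔽₂)`-equivariant `F : M₂(𝔽₂) → 𝔽₂²` (`datum_mul`, `datum_conj`, every automorphism of `E[2]` being
Galois); it kills every `B + B²` because the square of a level-`1` realisation of `B` has level-`2` datum
`B + B²` (`datum_sq_one`) and `[x, s²] = 0`; so `F = 0` (`twoByTwo_equivariant_eq_zero_of_sq`).
[cite: LawsonWuthrich2016, §3 (Lemma 6 and the case p = 2)] [cite: GrossLMS1991, §9 Prop. 9.1] -/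
theorem forall_torsionFixing_sq_h1Eval_eq_zero_of_cube [W.IsElliptic] (hsurj : W.HasSurjectiveModNGaloisRep 2)
    (hsurj4 : W.HasSurjectiveModNGaloisRep 4) (hsurj8 : W.HasSurjectiveModNGaloisRep 8)
    (x : galH1Torsion W (2 : ℤ)) (hx : ∀ h ∈ torsionFixing W ((2 : ℤ) ^ (2 + 1)), h1Eval W (2 : ℤ) x h = 0) :
    ∀ h ∈ torsionFixing W ((2 : ℤ) ^ 2), h1Eval W (2 : ℤ) x h = 0 := by
  classical
  have hsurj4' : W.HasSurjectiveModNGaloisRep ((2 : ℤ) ^ (1 + 1)) := by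
    rw [show ((2 : ℤ) ^ (1 + 1)) = 4 by norm_num]; exact hsurj4
  have hsurj8' : W.HasSurjectiveModNGaloisRep ((2 : ℤ) ^ (2 + 1)) := by
    rw [show ((2 : ℤ) ^ (2 + 1)) = 8 by norm_num]; exact hsurj8
  have hT3 : torsionFixing W ((2 : ℤ) ^ (2 + 1)) ≤ torsionFixing W (2 : ℤ) :=
    KolyvaginLowerBoundAtTwo.torsionFixing_le_of_dvd W (dvd_pow_self 2 (by omega))
  have hT2 : torsionFixing W ((2 : ℤ) ^ 2) ≤ torsionFixing W (2 : ℤ) :=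
    KolyvaginLowerBoundAtTwo.torsionFixing_le_of_dvd W (dvd_pow_self 2 (by omega))
  have hT1 : torsionFixing W ((2 : ℤ) ^ 1) ≤ torsionFixing W (2 : ℤ) := by rw [pow_one]
  -- ### realisations at levels `2` and `1`
  choose ρ₂ hρ₂ using fun A : geomTorsion W (2 : ℤ) →+ geomTorsion W (2 : ℤ) ↦
    exists_datum_eq_of_hasSurjectiveModNGaloisRep W (k := 2) (by norm_num) hsurj8' A
  choose ρ₁ hρ₁ using fun A : geomTorsion W (2 : ℤ) →+ geomTorsion W (2 : ℤ) ↦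
    exists_datum_eq_of_hasSurjectiveModNGaloisRep W (k := 1) le_rfl hsurj4' A
  have hρ₂T : ∀ A, ρ₂ A ∈ torsionFixing W (2 : ℤ) := fun A ↦ hT2 (mem_torsionFixing_zpow_of_datum W (hρ₂ A))
  have hρ₁T : ∀ A, ρ₁ A ∈ torsionFixing W (2 : ℤ) := fun A ↦ hT1 (mem_torsionFixing_zpow_of_datum W (hρ₁ A))
  -- ### transfer: `[x, g]` depends only on the level-`2` datum of `g`
  have transfer : ∀ (A : geomTorsion W (2 : ℤ) →+ geomTorsion W (2 : ℤ)) {g : absoluteGaloisGroup ℚ},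
      (∀ (P : geomPoints W) (v : geomTorsion W (2 : ℤ)), ((2 : ℤ) ^ 2) • P = (v : geomPoints W) →
        g • P = P + (A v : geomPoints W)) →
      h1Eval W (2 : ℤ) x g = h1Eval W (2 : ℤ) x (ρ₂ A) := by
    intro A g hg
    have hmem : g * (ρ₂ A)⁻¹ ∈ torsionFixing W ((2 : ℤ) ^ (2 + 1)) :=
      mul_inv_mem_torsionFixing_zpow_succ_of_datum W (by norm_num : 1 ≤ 2) (hρ₂ A) hg
    have e : g = (g * (ρ₂ A)⁻¹) * ρ₂ A := by group
    rw [e, h1Eval_mul W _ x (hT3 hmem), hx _ hmem, zero_add]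
  -- ### a frame `E[2] ≃ 𝔽₂²`; matrices ↦ endomorphisms of `E[2]`
  haveI : Fact (Nat.Prime 2) := ⟨Nat.prime_two⟩
  have h2T : ∀ P : geomTorsion W (2 : ℤ), 2 • P = 0 := fun P ↦ AddSubgroup.torsionBy.nsmul P
  have hcard : Nat.card (geomTorsion W (2 : ℤ)) = 2 ^ 2 := natCard_geomTorsion_two_rat W
  obtain ⟨e⟩ := KolyvaginImage.nonempty_addEquiv_of_card_eq_sq h2T hcard
  let endo : Matrix (Fin 2) (Fin 2) (ZMod 2) → (geomTorsion W (2 : ℤ) →+ geomTorsion W (2 : ℤ)) := fun M ↦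
    e.symm.toAddMonoidHom.comp ((Matrix.toLin' M).toAddMonoidHom.comp e.toAddMonoidHom)
  have hendo : ∀ (M : Matrix (Fin 2) (Fin 2) (ZMod 2)) (v : geomTorsion W (2 : ℤ)),
      endo M v = e.symm (M *ᵥ e v) := fun M v ↦ by
    simp [endo, Matrix.toLin'_apply]
  have endo_add : ∀ M N : Matrix (Fin 2) (Fin 2) (ZMod 2), endo (M + N) = endo M + endo N := fun M N ↦
    AddMonoidHom.ext fun v ↦ by rw [AddMonoidHom.add_apply, hendo, hendo, hendo, Matrix.add_mulVec, map_add]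
  have endo_mul : ∀ M N : Matrix (Fin 2) (Fin 2) (ZMod 2), endo (M * N) = (endo M).comp (endo N) := fun M N ↦
    AddMonoidHom.ext fun v ↦ by
      show endo (M * N) v = endo M (endo N v)
      rw [hendo, hendo, hendo, e.apply_symm_apply, Matrix.mulVec_mulVec]
  have endo_surj : ∀ A : geomTorsion W (2 : ℤ) →+ geomTorsion W (2 : ℤ), ∃ M, endo M = A := by
    intro A
    refine ⟨LinearMap.toMatrix' ((e.toAddMonoidHom.comp (A.comp e.symm.toAddMonoidHom)).toZModLinearMap 2), ?_⟩
    refine AddMonoidHom.ext fun v ↦ ?_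
    rw [hendo, ← Matrix.toLin'_apply, Matrix.toLin'_toMatrix']
    apply e.symm_apply_eq.mpr
    simp
  -- ### the additive map `F : M₂(𝔽₂) → 𝔽₂²`, `M ↦ [x, ρ₂ (endo M)]`
  have addF : ∀ M N : Matrix (Fin 2) (Fin 2) (ZMod 2), e (h1Eval W (2 : ℤ) x (ρ₂ (endo (M + N)))) =
      e (h1Eval W (2 : ℤ) x (ρ₂ (endo M))) + e (h1Eval W (2 : ℤ) x (ρ₂ (endo N))) := by
    intro M N
    rw [← map_add, endo_add, ← transfer (endo M + endo N) (datum_mul W (by norm_num : 1 ≤ 2) (hρ₂ _) (hρ₂ _)),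
      h1Eval_mul W _ x (hρ₂T _)]
  let F : Matrix (Fin 2) (Fin 2) (ZMod 2) →+ (Fin 2 → ZMod 2) :=
    AddMonoidHom.mk' (fun M ↦ e (h1Eval W (2 : ℤ) x (ρ₂ (endo M)))) addF
  have hF : ∀ M : Matrix (Fin 2) (Fin 2) (ZMod 2), F M = e (h1Eval W (2 : ℤ) x (ρ₂ (endo M))) := fun M ↦ rfl
  -- ### equivariance under `GL₂(𝔽₂)` (every automorphism of `E[2]` is Galois: `ρ̄_{W,2}` onto)
  have equiv : ∀ (g g' M : Matrix (Fin 2) (Fin 2) (ZMod 2)), g * g' = 1 → F (g * M * g') = g *ᵥ F M := by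
    intro g g' M hgg'
    have hg'g : g' * g = 1 := mul_eq_one_comm.mp hgg'
    let φ : geomTorsion W (2 : ℤ) ≃+ geomTorsion W (2 : ℤ) :=
      { toFun := fun v ↦ e.symm (g *ᵥ e v)
        invFun := fun v ↦ e.symm (g' *ᵥ e v)
        left_inv := fun v ↦ by
          show e.symm (g' *ᵥ e (e.symm (g *ᵥ e v))) = v
          rw [e.apply_symm_apply, Matrix.mulVec_mulVec, hg'g, Matrix.one_mulVec, e.symm_apply_apply]
        right_inv := fun v ↦ by
          show e.symm (g *ᵥ e (e.symm (g' *ᵥ e v))) = v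
          rw [e.apply_symm_apply, Matrix.mulVec_mulVec, hgg', Matrix.one_mulVec, e.symm_apply_apply]
        map_add' := fun v w ↦ by
          show e.symm (g *ᵥ e (v + w)) = e.symm (g *ᵥ e v) + e.symm (g *ᵥ e w)
          rw [map_add, Matrix.mulVec_add, map_add] }
    obtain ⟨τ, hτ⟩ := hsurj (Multiplicative.ofAdd φ)
    have hτv : ∀ v : geomTorsion W (2 : ℤ), τ • v = e.symm (g *ᵥ e v) := fun v ↦ by
      have h := galoisRepTorsion_apply W (2 : ℤ) τ v
      rw [hτ, toAdd_ofAdd] at h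
      exact h.symm
    have hτ'v : ∀ v : geomTorsion W (2 : ℤ), τ⁻¹ • v = e.symm (g' *ᵥ e v) := fun v ↦ by
      have h : τ • (e.symm (g' *ᵥ e v)) = v := by
        rw [hτv, e.apply_symm_apply, Matrix.mulVec_mulVec, hgg', Matrix.one_mulVec, e.symm_apply_apply]
      nth_rewrite 1 [← h]
      rw [inv_smul_smul]
    have hconj : endo (g * M * g') = (DistribSMul.toAddMonoidHom (geomTorsion W (2 : ℤ)) τ).comp
        ((endo M).comp (DistribSMul.toAddMonoidHom (geomTorsion W (2 : ℤ)) τ⁻¹)) :=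
      AddMonoidHom.ext fun v ↦ by
        show endo (g * M * g') v = τ • (endo M (τ⁻¹ • v))
        rw [hendo, hτ'v, hendo, e.apply_symm_apply, hτv, e.apply_symm_apply, Matrix.mulVec_mulVec,
          Matrix.mulVec_mulVec]
    rw [hF, hF, hconj, ← transfer _ (datum_conj W (hρ₂ (endo M)) τ), h1Eval_conj W _ x τ (hρ₂T _), hτv,
      e.apply_symm_apply]
  -- ### `F` kills `B + B²` (squares of level-`1` elements)
  have hsqF : ∀ M : Matrix (Fin 2) (Fin 2) (ZMod 2), F (M + M * M) = 0 := by
    intro M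
    have hss := datum_sq_one W (hρ₁ (endo M))
    rw [hF, endo_add, endo_mul, ← transfer _ hss, h1Eval_mul W _ x (hρ₁T _), h1Eval_two_add_self, map_zero]
  -- ### conclusion
  have hF0 : F = 0 := twoByTwo_equivariant_eq_zero_of_sq F equiv hsqF
  intro g hg
  obtain ⟨A, hA⟩ := exists_datum_of_mem_torsionFixing_zpow W hg
  obtain ⟨M, hM⟩ := endo_surj A
  have h := DFunLike.congr_fun hF0 M
  rw [AddMonoidHom.zero_apply, hF, hM, ← transfer A hA] at h
  exact (map_eq_zero_iff e e.injective).mp h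

end Descent

/-! ## §44 Entanglement is a level-`4` phenomenon: the theorems -/

section LevelFour

variable (W : WeierstrassCurve ℚ) [W.IsElliptic]

/-- **A CLASS OF `H¹(ℚ, E[2])` DYING ON `Γ_{ℚ(E[2^M])}` DIES ON `Γ_{ℚ(E[4])}`** (`M ≥ 2`, the `2`-adic tower of
`W` surjective — the habitat binder of crux 22136 / U). So the inflation kernel
`Inf H¹(Gal(ℚ(E[2^M])/ℚ), E[2]) ⊂ H¹(ℚ, E[2])` does not grow beyond level `4`:
`H¹(GL₂(ℤ/2^M), 𝔽₂²) = H¹(GL₂(ℤ/4), 𝔽₂²) (= 𝔽₂)` for every `M ≥ 2`. Proof: §43 — descend from level `2^M`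
to level `8` by squaring, then the level-`4 → 8` step. [cite: LawsonWuthrich2016, §3 (Lemma 6, Thm. 1 at p = 2)]
[cite: GrossLMS1991, §9 Prop. 9.1] -/
theorem forall_torsionFixing_four_h1Eval_eq_zero_of_forall_torsionFixing_pow
    (hρ : ∀ n : ℕ, 0 < n → W.HasSurjectiveModNGaloisRep ((2 : ℤ) ^ n)) {M : ℕ} (hM : 2 ≤ M)
    {x : galH1Torsion W (2 : ℤ)} (hx : ∀ h ∈ torsionFixing W ((2 ^ M : ℕ) : ℤ), h1Eval W (2 : ℤ) x h = 0) :
    ∀ h ∈ torsionFixing W (4 : ℤ), h1Eval W (2 : ℤ) x h = 0 := by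
  have hx' : ∀ h ∈ torsionFixing W ((2 : ℤ) ^ M), h1Eval W (2 : ℤ) x h = 0 := by
    have e : ((2 ^ M : ℕ) : ℤ) = (2 : ℤ) ^ M := by push_cast; rfl
    rw [e] at hx
    exact hx
  -- descent from level `2^(j+3)` to level `2^3`
  have descent : ∀ j : ℕ, (∀ h ∈ torsionFixing W ((2 : ℤ) ^ (j + 3)), h1Eval W (2 : ℤ) x h = 0) →
      ∀ h ∈ torsionFixing W ((2 : ℤ) ^ (2 + 1)), h1Eval W (2 : ℤ) x h = 0 := by
    intro j
    induction j with
    | zero => intro h; exact h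
    | succ j ih =>
      intro h
      apply ih
      have h' : ∀ h ∈ torsionFixing W ((2 : ℤ) ^ ((j + 2) + 1 + 1)), h1Eval W (2 : ℤ) x h = 0 := h
      exact forall_torsionFixing_h1Eval_eq_zero_descent W (k := j + 2) (by omega) (hρ _ (by omega)) x h'
  have hsurj : W.HasSurjectiveModNGaloisRep 2 := by simpa using hρ 1 one_pos
  have hsurj4 : W.HasSurjectiveModNGaloisRep 4 := by have h := hρ 2 two_pos; norm_num at h; exact h
  have hsurj8 : W.HasSurjectiveModNGaloisRep 8 := by have h := hρ 3 (by norm_num); norm_num at h; exact h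
  have h4 : ∀ h ∈ torsionFixing W ((2 : ℤ) ^ 2), h1Eval W (2 : ℤ) x h = 0 := by
    rcases Nat.exists_eq_add_of_le hM with ⟨j, rfl⟩
    rcases j with _ | j
    · exact hx'
    · have hx3 : ∀ h ∈ torsionFixing W ((2 : ℤ) ^ (j + 3)), h1Eval W (2 : ℤ) x h = 0 := by
        have e : 2 + (j + 1) = j + 3 := by omega
        rw [e] at hx'
        exact hx'
      exact forall_torsionFixing_sq_h1Eval_eq_zero_of_cube W hsurj hsurj4 hsurj8 x (descent j hx3)
  have e4 : ((2 : ℤ) ^ 2) = 4 := by norm_num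
  rw [e4] at h4
  exact h4

/-- **THE INFLATION KERNEL AT EVERY LEVEL `2^M` HAS AT MOST TWO ELEMENTS**: for the `2`-adic tower of `W`
surjective and `M ≥ 2`, two NON-ZERO classes of `H¹(ℚ, E[2])` dying on `Γ_{ℚ(E[2^M])}` are EQUAL (g8's
`eq_of_forall_torsionFixing_four_h1Eval_eq_zero` at level `4` ∘ the level-`4` theorem).
[cite: LawsonWuthrich2016, §3] [cite: GrossLMS1991, §9 Prop. 9.1] -/
theorem eq_of_forall_torsionFixing_pow_h1Eval_eq_zero
    (hρ : ∀ n : ℕ, 0 < n → W.HasSurjectiveModNGaloisRep ((2 : ℤ) ^ n)) {M : ℕ} (hM : 2 ≤ M)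
    {x y : galH1Torsion W (2 : ℤ)} (hx0 : x ≠ 0) (hy0 : y ≠ 0)
    (hx : ∀ h ∈ torsionFixing W ((2 ^ M : ℕ) : ℤ), h1Eval W (2 : ℤ) x h = 0)
    (hy : ∀ h ∈ torsionFixing W ((2 ^ M : ℕ) : ℤ), h1Eval W (2 : ℤ) y h = 0) : x = y := by
  have hsurj : W.HasSurjectiveModNGaloisRep 2 := by simpa using hρ 1 one_pos
  have hsurj4 : W.HasSurjectiveModNGaloisRep 4 := by have h := hρ 2 two_pos; norm_num at h; exact h
  exact eq_of_forall_torsionFixing_four_h1Eval_eq_zero W hsurj hsurj4 hx0 hy0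
    (forall_torsionFixing_four_h1Eval_eq_zero_of_forall_torsionFixing_pow W hρ hM hx)
    (forall_torsionFixing_four_h1Eval_eq_zero_of_forall_torsionFixing_pow W hρ hM hy)

/-- **On the habitat the `W`-side non-entanglement is AUTOMATIC AT EVERY DEPTH `M`.** For the `2`-adic tower
of `W` surjective and `#Sel₂(W) = 4` (WALL row 1), for every `M` SOME Selmer class does not die on
`Γ_{ℚ(E[2^M])}` (the inflation kernel has at most two elements, `Sel₂(W)` has four). This is the hypothesis
`hS` of the depth-`M` capstone `exists_kolyvaginPrime_pow_genusPair_selmer_of_cor34i_of_half`, so far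
discharged only at `M = 2` (`exists_selmer_h1Eval_ne_four_of_card_eq_four`). [cite: LawsonWuthrich2016, §3]
[cite: GrossLMS1991, §9 Prop. 9.1] -/
theorem exists_selmer_h1Eval_ne_pow_of_card_eq_four
    (hρ : ∀ n : ℕ, 0 < n → W.HasSurjectiveModNGaloisRep ((2 : ℤ) ^ n)) (h4 : Nat.card (W.selmerGroup 2) = 4)
    (M : ℕ) : ∃ c ∈ W.selmerGroup 2, ∃ h ∈ torsionFixing W ((2 ^ M : ℕ) : ℤ), h1Eval W (2 : ℤ) c h ≠ 0 := by
  -- it suffices to treat levels `M + 2 ≥ 2` (`Γ_{ℚ(E[2^{M+2}])} ⊆ Γ_{ℚ(E[2^M])}`)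
  have hle : torsionFixing W ((2 ^ (M + 2) : ℕ) : ℤ) ≤ torsionFixing W ((2 ^ M : ℕ) : ℤ) :=
    KolyvaginLowerBoundAtTwo.torsionFixing_le_of_dvd W (Int.natCast_dvd_natCast.mpr (pow_dvd_pow 2 (by omega)))
  suffices h : ∃ c ∈ W.selmerGroup 2, ∃ h ∈ torsionFixing W ((2 ^ (M + 2) : ℕ) : ℤ), h1Eval W (2 : ℤ) c h ≠ 0 by
    obtain ⟨c, hc, h, hh, hne⟩ := h
    exact ⟨c, hc, h, hle hh, hne⟩
  by_contra hcon
  push Not at hcon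
  have hne : ∃ x ∈ W.selmerGroup 2, x ≠ 0 := by
    by_contra h
    push Not at h
    have : Nat.card (W.selmerGroup 2) = 1 := by
      rw [(AddSubgroup.eq_bot_iff_forall _).mpr h, AddSubgroup.card_bot]
    omega
  obtain ⟨x, hxS, hx0⟩ := hne
  have hx2 : addOrderOf x = 2 := by
    have h2 : (2 : ℕ) • x = 0 := by
      rw [← natCast_zsmul]
      exact_mod_cast zsmul_galH1Torsion_eq_zero W (2 : ℤ) x
    have hdvd : addOrderOf x ∣ 2 := addOrderOf_dvd_of_nsmul_eq_zero h2
    have hne1 : addOrderOf x ≠ 1 := by rw [Ne, AddMonoid.addOrderOf_eq_one_iff]; exact hx0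
    rcases (Nat.dvd_prime Nat.prime_two).mp hdvd with h | h
    · exact absurd h hne1
    · exact h
  have hne' : ∃ y ∈ W.selmerGroup 2, y ≠ 0 ∧ y ≠ x := by
    by_contra h
    push Not at h
    have hle' : W.selmerGroup 2 ≤ AddSubgroup.zmultiples x := by
      intro y hy
      by_cases hy0 : y = 0
      · rw [hy0]; exact zero_mem _
      · rw [h y hy hy0]; exact AddSubgroup.mem_zmultiples x
    have hdvd := AddSubgroup.card_dvd_of_le hle'
    rw [Nat.card_zmultiples, hx2, h4] at hdvd
    omega
  obtain ⟨y, hyS, hy0, hyx⟩ := hne'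
  exact hyx (eq_of_forall_torsionFixing_pow_h1Eval_eq_zero W hρ (by omega) hy0 hx0 (hcon y hyS) (hcon x hxS))

end LevelFour

end Summit.BirchSwinnertonDyer.BirchSwinnertonDyer.Theorems.GenusKolyTwistingPrime

end
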